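import Summits.AtomisticToContinuum.BoseEinsteinCondensation.Theses.BECFeynmanVortexArea
import Summits.AtomisticToContinuum.BoseEinsteinCondensation.Theorems.BECConjugateDominationHardCoreExtensionBoundedPositiveMinimiser
import Summits.AtomisticToContinuum.BoseEinsteinCondensation.Theorems.BECInsertionCorrectorCorrectorClosureFKTranslate
import Literature.MathematicalPhysics.QuantumManyBody.PeriodicGroundStateFeynmanKacProofs
import HarnessLib

/-!
# Route `BECFeynmanVortexArea`, support item `TorusGroundState` (stmt-AtomisticToContinuum-12606) —
# the torus ground state from the Feynman–Kac package, modulo `C¹`-regularity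

For a bounded repulsive finite-range pair potential `v`, every `N` and every `L > 0`, the periodic
`N`-body energy on the torus of side `L` is attained in the `C¹` Bose class `PeriodicTrialState N L`
by a real, strictly positive, translation-invariant state (the route decl `TorusGroundState`).
This file assembles everything but one classical input from the tree:

* the periodisation of a bounded finite-range `v` is bounded
  (`…ThirdLawCurrentFloor.exists_periodizedPotential_le`);
* the Perron–Frobenius–Feynman–Kac ground state `Ψ₀` of `-Δ + ∑ v^per` on the torus exists for
  `N ≥ 1` (`PeriodicGroundStateFeynmanKac_holds`: a witness of `IsPeriodicGroundStateFK v L Ψ₀`,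
  continuous, strictly positive, Bose symmetric, cell-normalised, `periodicGroundStateEnergy ≠ ⊤`);
* `Ψ₀` is invariant under common translations of all particles
  (`…HealingScaleKacInsertion.fkGroundState_add_const_eq`: uniqueness of the witness);
* a `C¹` witness read as a complex periodic trial state has `periodicEnergy ≤ E₀`, hence `= E₀`
  (`periodicEnergy_le_of_isPeriodicGroundStateFK`: Fatou bound of the kinetic energy by the free
  small-time form, `kinetic_le_liminf_sqIncrCell`, against the eigenfunction bound
  `sqIncrCell_div_eventually_le`; adapted from `positiveMinimiser_of_isPeriodicGroundStateFK`);
* `N = 0`: the constant state `1` on the one-point configuration space (cell of volume `1`).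

The remaining input, **`C¹`-regularity of the Feynman–Kac ground state for bounded measurable
periodised potentials** (elliptic regularity; in the tree's language: the Duhamel identity against
the free heat operator plus Gaussian smoothing), enters `torusGroundState_of_regularity` as an
explicit hypothesis with the signature of stub `stub_periodicGroundStateRegularity` of
`Cruxes/HardCoreExtension/Lines/third-law-current-floor.lean`. [folklore] (Reed–Simon IV
Thm XIII.44/XIII.47; Gilbarg–Trudinger Thm 8.8 / 9.15 for the classical regularity statement.)
-/

noncomputable section

namespace Summit.AtomisticToContinuum.BoseEinsteinCondensation.Theorems.TorusGroundState

open MeasureTheory Filter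
open scoped ENNReal NNReal Topology
open Literature.MathematicalPhysics.QuantumManyBody.BoseGas
open Summit.AtomisticToContinuum.BoseEinsteinCondensation.Cruxes.HardCoreExtension.ThirdLawCurrentFloor
  (exists_periodizedPotential_le integral_cellN_sq_eq_one_of_isPeriodicGroundStateFK
    integral_cellN_mul_pfkReal_of_isPeriodicGroundStateFK)
open Summit.AtomisticToContinuum.BoseEinsteinCondensation.Theorems.CorrectorClosure.HealingScaleKacInsertion
  (fkGroundState_add_const_eq)

variable {N : ℕ} {L : ℝ} {v : ℝ → ℝ≥0∞}

/-! ### A `C¹` Feynman–Kac ground state attains the periodic energy -/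

/-- **The periodic energy of a `C¹` Feynman–Kac ground state is at most `E₀`.** For `L > 0`, `v`
measurable with `v^per ≤ C`, a `C¹` witness `Ψ₀` of `IsPeriodicGroundStateFK v L Ψ₀`, and a periodic
trial state `Ψ` whose wave function is `X ↦ Ψ₀ X` (read in `ℂ`):
`periodicEnergy v Ψ ≤ periodicGroundStateEnergy v N L`. The potential part is
`∫_cell Ψ₀² V^per ≤ E₀` and the kinetic part is at most `E₀ - ∫_cell Ψ₀² V^per` by Fatou
(`kinetic_le_liminf_sqIncrCell`) and the eigenfunction bound (`sqIncrCell_div_eventually_le`).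
Adapted from `positiveMinimiser_of_isPeriodicGroundStateFK` (same argument, the wave function kept
explicit). [cite: ChungZhao1995, Thm 3.27 and Prop 3.29 (81)] -/
theorem periodicEnergy_le_of_isPeriodicGroundStateFK (hL : 0 < L) (hv : Measurable v) {C : ℝ≥0}
    (hC : ∀ x, periodizedPotential v L x ≤ C) {Ψ₀ : Config N → ℝ}
    (hGS : IsPeriodicGroundStateFK v L Ψ₀) (hC1 : ContDiff ℝ 1 Ψ₀) (Ψ : PeriodicTrialState N L)
    (hΨ : Ψ.ψ = fun X => ((Ψ₀ X : ℝ) : ℂ)) :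
    periodicEnergy v Ψ ≤ periodicGroundStateEnergy v N L := by
  have hcont : Continuous Ψ₀ := hC1.continuous
  have hper := hGS.periodic
  have hnn := hGS.nonneg
  have hΨm : Measurable Ψ₀ := hcont.measurable
  obtain ⟨M, -, hM⟩ := exists_bound_of_continuous_periodic hL hcont hper
  have hsq : Integrable (fun X => Ψ₀ X ^ 2) (volume.restrict (cellN N L)) :=
    (memLp_two_cellN_of_bound L hΨm hM).integrable_sq
  have hnorm : ∫ X in cellN N L, Ψ₀ X ^ 2 = 1 :=
    integral_cellN_sq_eq_one_of_isPeriodicGroundStateFK hL hGS hcont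
  -- the eigenvalue in real form
  set lam : ℝ := (periodicGroundStateEnergy v N L).toReal with hlam
  have hE₀ : periodicGroundStateEnergy v N L = ENNReal.ofReal lam :=
    (ENNReal.ofReal_toReal hGS.energy_ne_top).symm
  have heig : ∀ t : ℝ, 0 < t →
      Real.exp (-(lam * t)) ≤ ∫ X in cellN N L, Ψ₀ X * pfkReal v L t Ψ₀ X := fun t ht =>
    (integral_cellN_mul_pfkReal_of_isPeriodicGroundStateFK hL hv hGS hcont ht.le).ge
  -- the potential part
  set Pot : ℝ := ∫ X in cellN N L, Ψ₀ X ^ 2 * (periodicInteraction v L X).toReal with hPot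
  have hPot0 : 0 ≤ Pot := integral_nonneg fun X => mul_nonneg (sq_nonneg _) ENNReal.toReal_nonneg
  have hPotle : Pot ≤ lam :=
    setIntegral_cellN_sq_mul_periodicInteraction_le hv hL hC hcont hper hnn hnorm heig
  have hpotE : ∫⁻ X in cellN N L, ENNReal.ofReal (Ψ₀ X ^ 2) * periodicInteraction v L X =
      ENNReal.ofReal Pot :=
    setLIntegral_cellN_sq_mul_periodicInteraction_eq_ofReal hv hC hΨm hsq
  -- the kinetic part: Fatou against the eigenfunction bound
  have hkin : ∫⁻ X in cellN N L, realKinetic Ψ₀ X ≤ ENNReal.ofReal (lam - Pot) := by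
    refine ENNReal.le_of_forall_pos_le_add fun ε hε _ => ?_
    have hε' : (0 : ℝ) < ε := by exact_mod_cast hε
    have hK' : lam - Pot < lam - Pot + ε := by linarith
    have hev := sqIncrCell_div_eventually_le hv hL hC hcont hper hnn hnorm heig hK'
    calc ∫⁻ X in cellN N L, realKinetic Ψ₀ X
        ≤ liminf (fun t : ℝ≥0 => (ENNReal.ofReal (2 * t))⁻¹ * sqIncrCell L t Ψ₀) (𝓝[>] 0) :=
          kinetic_le_liminf_sqIncrCell L hC1
      _ ≤ liminf (fun _ : ℝ≥0 => ENNReal.ofReal (lam - Pot + ε)) (𝓝[>] 0) := liminf_le_liminf hev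
      _ = ENNReal.ofReal (lam - Pot + ε) := liminf_const _
      _ ≤ ENNReal.ofReal (lam - Pot) + ENNReal.ofReal ε := ENNReal.ofReal_add_le
      _ = ENNReal.ofReal (lam - Pot) + ε := by rw [ENNReal.ofReal_coe_nnreal]
  -- the energy identity of the trial state `X ↦ Ψ₀ X`
  have hΨeq : Ψ.ψ = fun X => (((1 * Ψ₀ X : ℝ)) : ℂ) := by
    rw [hΨ]; funext X; rw [one_mul]
  have hE : periodicEnergy v Ψ = (∫⁻ X in cellN N L, realKinetic Ψ₀ X) +
      ∫⁻ X in cellN N L, ENNReal.ofReal (Ψ₀ X ^ 2) * periodicInteraction v L X := by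
    rw [periodicEnergy_of_ofReal_mul Ψ hC1 hΨeq v, one_pow, ENNReal.ofReal_one, one_mul]
  rw [hE, hpotE, hE₀]
  calc (∫⁻ X in cellN N L, realKinetic Ψ₀ X) + ENNReal.ofReal Pot
      ≤ ENNReal.ofReal (lam - Pot) + ENNReal.ofReal Pot := add_le_add hkin le_rfl
    _ = ENNReal.ofReal lam := by
        rw [← ENNReal.ofReal_add (sub_nonneg.2 hPotle) hPot0, sub_add_cancel]

/-! ### The assembly, modulo regularity -/

/-- **`TorusGroundState` from the `C¹`-regularity of the Feynman–Kac ground state.** If every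
witness of `IsPeriodicGroundStateFK v L` for `N ≥ 1`, `L > 0`, `v` measurable with bounded
periodisation is `C¹` (elliptic regularity — the signature of stub
`stub_periodicGroundStateRegularity` of line `third-law-current-floor`), then for every bounded
repulsive finite-range `v`, every `N` and every `L > 0` the periodic `N`-body energy is attained in
`PeriodicTrialState N L` by a real, strictly positive, translation-invariant state, and is finite.
Proof: `N = 0` — the constant state; `N ≥ 1` — bounded periodisation, the Feynman–Kac ground state
(`PeriodicGroundStateFeynmanKac_holds`), its regularity (hypothesis), the energy identity
(`periodicEnergy_le_of_isPeriodicGroundStateFK` and the variational principle), strict positivity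
of the witness, and translation invariance by uniqueness (`fkGroundState_add_const_eq`).
[cite: ReedSimonIV1978, Thm XIII.47] -/
theorem torusGroundState_of_regularity
    (hreg : ∀ (N : ℕ) (L : ℝ) (v : ℝ → ℝ≥0∞), 1 ≤ N → 0 < L → Measurable v →
      (∃ C : ℝ≥0, ∀ x, periodizedPotential v L x ≤ C) →
      ∀ Ψ₀ : Config N → ℝ, IsPeriodicGroundStateFK v L Ψ₀ → ContDiff ℝ 1 Ψ₀) :
    Summit.AtomisticToContinuum.BoseEinsteinCondensation.Theses.BECFeynmanVortexArea.TorusGroundState := by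
  intro v hv hM N L hL
  cases N with
  | zero =>
    -- the constant state `1` on the one-point configuration space (cell of volume `1`)
    let Ψ : PeriodicTrialState 0 L :=
      { ψ := fun _ => 1
        contDiff := contDiff_const
        periodic := fun _ _ _ => rfl
        symm := fun _ _ => rfl
        norm_eq := by rw [setLIntegral_const, volume_cellN]; simp }
    have hE : periodicEnergy v Ψ = 0 := by
      refine (lintegral_congr fun X => ?_).trans lintegral_zero
      simp [Ψ, kineticDensity, periodicInteraction]
    have hE₀ : periodicGroundStateEnergy v 0 L = 0 :=
      le_antisymm ((periodicGroundStateEnergy_le v Ψ).trans (le_of_eq hE)) bot_le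
    refine ⟨Ψ, by rw [hE, hE₀], by rw [hE₀]; exact ENNReal.zero_ne_top, fun X => ?_, fun s X => rfl⟩
    simp [Ψ]
  | succ n =>
    -- bounded periodisation
    obtain ⟨M, hvM⟩ := hM
    have hM' : ∃ M : ℝ≥0∞, M ≠ ⊤ ∧ ∀ r, v r ≤ M := ⟨M, ENNReal.coe_ne_top, hvM⟩
    obtain ⟨C, hC⟩ := exists_periodizedPotential_le hv hM' hL
    have hN : 1 ≤ n + 1 := Nat.le_add_left 1 n
    -- the Feynman–Kac ground state, its regularity and translation invariance
    obtain ⟨Ψ₀, hGS, -, hpos⟩ := PeriodicGroundStateFeynmanKac_holds (n + 1) L v hN hL hv.1 ⟨C, hC⟩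
    have hC1 : ContDiff ℝ 1 Ψ₀ := hreg (n + 1) L v hN hL hv.1 ⟨C, hC⟩ Ψ₀ hGS
    have htr : ∀ (s : Space) (X : Config (n + 1)), Ψ₀ (fun i => X i + s) = Ψ₀ X :=
      fun s X => fkGroundState_add_const_eq hL hGS s X
    -- the trial state `X ↦ Ψ₀ X` and its energy
    have hnormΨ : ∫⁻ X in cellN (n + 1) L, ((‖((Ψ₀ X : ℝ) : ℂ)‖₊ : ℝ≥0∞)) ^ 2 = 1 := by
      have h1 : ∀ X, ((‖((Ψ₀ X : ℝ) : ℂ)‖₊ : ℝ≥0∞)) ^ 2 = ENNReal.ofReal (Ψ₀ X) ^ 2 := fun X => by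
        rw [ennnorm_sq_ofReal_periodic, ENNReal.ofReal_pow (hGS.nonneg X)]
      simp_rw [h1]
      exact hGS.norm_eq
    let Ψ : PeriodicTrialState (n + 1) L :=
      { ψ := fun X => ((Ψ₀ X : ℝ) : ℂ)
        contDiff := Complex.ofRealCLM.contDiff.comp hC1
        periodic := fun X i k => by
          show ((Ψ₀ (X + Pi.single i (EuclideanSpace.single k L)) : ℝ) : ℂ) = ((Ψ₀ X : ℝ) : ℂ)
          rw [hGS.periodic]
        symm := fun σ X => by
          show ((Ψ₀ (X ∘ σ) : ℝ) : ℂ) = ((Ψ₀ X : ℝ) : ℂ)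
          rw [hGS.symm]
        norm_eq := hnormΨ }
    have hΨ : Ψ.ψ = fun X => ((Ψ₀ X : ℝ) : ℂ) := rfl
    have hEeq : periodicEnergy v Ψ = periodicGroundStateEnergy v (n + 1) L :=
      le_antisymm (periodicEnergy_le_of_isPeriodicGroundStateFK hL hv.1 hC hGS hC1 Ψ hΨ)
        (periodicGroundStateEnergy_le v Ψ)
    refine ⟨Ψ, hEeq, hGS.energy_ne_top, fun X => ⟨?_, ?_⟩, fun s X => ?_⟩
    · show 0 < ((Ψ₀ X : ℝ) : ℂ).re
      rw [Complex.ofReal_re]; exact hpos X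
    · show ((Ψ₀ X : ℝ) : ℂ).im = 0
      exact Complex.ofReal_im _
    · show ((Ψ₀ (fun i => X i + s) : ℝ) : ℂ) = ((Ψ₀ X : ℝ) : ℂ)
      rw [htr]

end Summit.AtomisticToContinuum.BoseEinsteinCondensation.Theorems.TorusGroundState

end
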